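/-
Copyright (c) 2026 the pub-hodgecm-mathlib formalisation cell (harness21).  Prover seat hodgecm-mathlib-K2E3-p06 (g4), Track B «K2-LIT», engine E3, unit U4 «Keys»; deal (D61)
LINE LEAD of the open leaf (U4f-χ₁-ram-one), design D-I «THE VANISHING FUNCTIONAL» (`K2/K2E3-p06/g4/DESIGN-M2-U4fRamifiedChar.K2E3-p06-g4.md`), brick (V2) with K2E3-r01 (g3)'s
normalisation fix (JUNK-SCREEN 05:27:06Z: average only over groups that FIX `f(1)` — here the compact part of the inducing subgroup); 2026-09-04.
KERNEL module: THEOREMS ONLY (no definition, no named fact, no `sorry`, no instance, no notation).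
-/
import Summits.HodgeConjecture.HodgeConjecture.Theorems.K2E3IntertwiningKernelOfReducible   -- ★ p857640 (this seat, (V1)): `exists_section_apply_one_ne_zero_forall_intertwiningIntegral_eq_zero`
import Literature.NumberTheory.Automorphic.CompactOpenAveraging                             -- ★ `IsLeftTransversal`, `exists_isLeftTransversal`, `IsLeftTransversal.sum_mul_left`, `Representation.avgProj` kit
import HarnessLib

/-!
# K2 ∕ E3 «EllipticInputs», unit U4 «Keys» — (U4f-χ₁-ram-one) brick (V2): TWISTED FINITE AVERAGES, AND THE TYPE VECTOR OF A `G`-SUBREPRESENTATION OF `i_G(χ)`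
# «inside any `G`-stable `V ∋ f` with `f(1) ≠ 0` there is `f′` with `f′(1) ≠ 0` on which the compact part of the Borel acts by the inducing character»
# [BernsteinZelevinsky1976 §2.3; Casselman1995 §2.1, §3.3; Roche1998 §3; Bump1997 §4.4]

Cell hodgecm-mathlib (D-0151), FLOOR 0, Track B «K2-LIT», engine E3, crux item H413 = stmt-HodgeConjecture-24833 (route `HCCMUnconditional`, no route verbs); target BY NAME
the OPEN leaf `…K2E3EllipticInputs.U4Keys.sig_K2E3KeysThmTwoContractingRamifiedCharOne` (U4Keys ED. 7), design D-I (V2).  Author K2E3-p06 (g4), line lead (D61).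
`--supports stmt-HodgeConjecture-24833 --as helper`; THEOREMS ONLY.  NOT THE PAYER: second brick of the line; generic in §1, CM dress in §2.

THE POINT.  (V1) ★ p857640 produces, for a reducible `i_G(χ)` with `χ₁` contracting, a `G`-subrepresentation `V ≠ ⊥` killed by `J(w₀, χ)` and `f ∈ V` with `f(1) ≠ 0`.  (V3)–(V4) need
`f` in NORMAL FORM: an eigenvector of the compact part `B_K = B ∩ K_v` of the Borel (so of `T(𝒪_v)` and `N(𝒪_v)`) for the inducing character.  §1 is the group-free TWISTED AVERAGE
`v′ = Σ_{r ∈ R} θ(r)⁻¹ ρ(r) v` over a finite transversal `R` of `B ∕ (B ∩ T)` (`B` compact, `T` an open subgroup fixing `v`, `θ : G → k` multiplicative and non-vanishing on `B` and `= 1` on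
`B ∩ T`): `ρ(b) v′ = θ(b) v′` for `b ∈ B` (★ `IsLeftTransversal.sum_mul_left`), `v′` stays in every `ρ`-stable submodule containing `v` — the `θ`-twisted twin of ★ `Representation.avgProj`
(Bernstein–Zelevinsky's idempotent `e_{B,θ}` as a finite sum).  §2 applies it to `Ind_P^G τ` (★ `smoothIndRep`, one-dimensional `τ`) with `B ≤ P` compact and `θ := f ↦ f(·)∕f(1)` read on
`P` — i.e. `θ(p) = τ(p)`: the section property `f(p g) = τ(p) f(g)` makes `θ` multiplicative on `B`, and `= 1` on `B ∩ Stab(f)` BECAUSE `f(1) ≠ 0` (`f(s) = (s·f)(1) = f(1)`), so no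
open-kernel lemma is needed; `f′(1) = |R|·f(1) ≠ 0` (char 0).  §3 is the CM dress at `B_K = (borelU) ⊓ K_v` of `U(Φ₃)(L⁺_v)`, composed with (V1).
* §1 `exists_sum_twisted_eigenvector` (generic: `k`-linear `ρ`, compact `B`, open `T`).
* §2 `exists_typeVector_of_mem` (generic smooth induction from a one-dimensional `τ`): `∃ f′ ∈ V, f′(1) ≠ 0 ∧ ∀ b ∈ B, ρ(b) f′ = τ(b) • f′`.
* §3 **`exists_typeVector_forall_intertwiningIntegral_eq_zero`** — (V1)+(V2) at `U(Φ₃)(L⁺_v)`: for a reducible `i_G(χ₁, χ₂)` with `χ₁` non-unitary contracting (ANY conductor) there are a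
  subrepresentation `V ≠ ⊥` all of whose members have vanishing intertwining integrals `∫_N f(w₀ n g) dn = 0`, and `f ∈ V` with `f(1) ≠ 0` which is a `B ∩ K_v`-EIGENVECTOR for the
  inducing character (`(b·f) = f(b)∕f(1) • f`).
HONEST LABEL: HC_CM is proved only modulo the 7 printed citations (2 remaining named inputs: hLiu418 = stmt-HodgeConjecture-24832, h413 = stmt-HodgeConjecture-24833)
until rung 0 closes; count-neutral — this file does NOT pay the leaf; no printed citation is discharged.

## References
* [BernsteinZelevinsky1976] I. N. Bernstein, A. V. Zelevinsky, Russian Math. Surveys 31:3 (1976), §2.3 (the idempotents `e_K` ∕ their twisted forms as averages).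
* [Casselman1995] W. Casselman, *Introduction to the theory of admissible representations of `p`-adic reductive groups* (1995), §2.1, §3.3.
* [Roche1998] A. Roche, *Types and Hecke algebras for principal series representations of split reductive p-adic groups*, Ann. Sci. ÉNS 31 (1998), §3 (the pair `(J, χ̃)`).
* [Bump1997] D. Bump, *Automorphic Forms and Representations* (1997), §4.4 (the idempotents `e_{K,χ}`).
-/

set_option autoImplicit false
-- the mandated namespace has the single-problem summit's repeated segment (`HodgeConjecture.HodgeConjecture`)
set_option linter.dupNamespace false

noncomputable section

open NumberField IsDedekindDomain MeasureTheory
open scoped Matrix MatrixGroups NNReal ENNReal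
open Literature.NumberTheory Literature.NumberTheory.Automorphic Literature.NumberTheory.Automorphic.UnitaryGroup
open Literature.NumberTheory.Rogawski1990 Literature.NumberTheory.GaloisRepresentations

namespace Summit.HodgeConjecture.HodgeConjecture.Cruxes.H413.K2E3TypeVectorOfSubrep

open Summit.HodgeConjecture.HodgeConjecture.Cruxes.H413

/-! ## §1 The twisted finite average over a compact subgroup (group-free) -/

section Generic

variable {k : Type*} [Field k] {G : Type*} [Group G] {W : Type*} [AddCommGroup W] [Module k W] (ρ : Representation k G W)

/-- **THE `θ`-TWISTED AVERAGE IS A `(B, θ)`-EIGENVECTOR.**  `B` a compact subgroup, `T` an open subgroup fixing `v`, `θ : G → k` multiplicative and non-vanishing on `B` and trivial on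
`B ∩ T`; for any finite left transversal `R` of `B ∕ (B ∩ T)` (★ `exists_isLeftTransversal`) the vector `v′ = Σ_{r ∈ R} θ(r)⁻¹ • ρ(r) v` satisfies `ρ(b) v′ = θ(b) • v′` for every `b ∈ B`
(reindex `r ↦ rep(b r)` — ★ `IsLeftTransversal.sum_mul_left` applied to the right-`(B ∩ T)`-invariant `x ↦ θ(x)⁻¹ • ρ(x) v`). [cite: BernsteinZelevinsky1976, §2.3] [cite: Bump1997, §4.4] -/
theorem sum_twisted_eigenvector {B T : Subgroup G} {R : Finset G} (hR : IsLeftTransversal B (B ⊓ T) R) {v : W} (hTv : ∀ t ∈ T, ρ t v = v)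
    (θ : G → k) (hθmul : ∀ x ∈ B, ∀ y ∈ B, θ (x * y) = θ x * θ y) (hθ0 : ∀ x ∈ B, θ x ≠ 0) (hθS : ∀ s ∈ B, s ∈ T → θ s = 1)
    {b : G} (hb : b ∈ B) :
    ρ b (∑ r ∈ R, (θ r)⁻¹ • ρ r v) = θ b • ∑ r ∈ R, (θ r)⁻¹ • ρ r v := by
  -- the right-`(B ∩ T)`-invariant function `F x = θ(x)⁻¹ • ρ(x) v`
  have hF : ∀ x ∈ B, ∀ s ∈ B ⊓ T, (θ (x * s))⁻¹ • ρ (x * s) v = (θ x)⁻¹ • ρ x v := by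
    intro x hx s hs
    rw [hθmul x hx s hs.1, hθS s hs.1 hs.2, mul_one, map_mul, Module.End.mul_apply, hTv s hs.2]
  have hsum := hR.sum_mul_left (fun x => (θ x)⁻¹ • ρ x v) hF hb
  -- `ρ(b) Σ θ(r)⁻¹ ρ(r) v = Σ θ(r)⁻¹ ρ(b r) v = θ(b) Σ θ(b r)⁻¹ ρ(b r) v = θ(b) Σ θ(r)⁻¹ ρ(r) v`
  conv_rhs => rw [← hsum]
  rw [map_sum, Finset.smul_sum]
  refine Finset.sum_congr rfl fun r hr => ?_
  have hrB : r ∈ B := hR.mem_of_mem r hr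
  rw [map_smul, map_mul, Module.End.mul_apply, hθmul b hb r hrB, mul_inv, smul_smul, ← mul_assoc, mul_inv_cancel₀ (hθ0 b hb), one_mul]

/-- The twisted average stays in every `ρ`-stable submodule containing `v`. [cite: BernsteinZelevinsky1976, §2.3] -/
theorem sum_twisted_mem (V : Subrepresentation ρ) {v : W} (hv : v ∈ V) (θ : G → k) (R : Finset G) :
    (∑ r ∈ R, (θ r)⁻¹ • ρ r v) ∈ V :=
  V.toSubmodule.sum_mem fun r _ => V.toSubmodule.smul_mem _ (V.apply_mem_toSubmodule r hv)

end Generic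

/-! ## §2 Smooth induction from a one-dimensional `τ`: the type vector of a subrepresentation -/

section Induced

variable {G : Type*} [Group G] [TopologicalSpace G] [IsTopologicalGroup G] (H : Subgroup G) (τ : Representation ℂ ↥H ℂ)

omit [TopologicalSpace G] [IsTopologicalGroup G] in
/-- The scalar by which `h ∈ H` acts in a one-dimensional `τ`: `τ h z = (τ h 1) * z`. [folklore] -/
theorem apply_eq_mul_one (h : ↥H) (z : ℂ) : τ h z = τ h 1 * z := by
  have : z = z • (1 : ℂ) := by rw [smul_eq_mul, mul_one]
  conv_lhs => rw [this, map_smul]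
  rw [smul_eq_mul, mul_comm]

/-- `toFun` of a finite sum of sections, pointwise. [folklore] -/
theorem toFun_sum_apply {ι : Type*} (s : Finset ι) (φ : ι → Representation.SmoothInd H τ) (x : G) :
    (∑ i ∈ s, φ i).toFun x = ∑ i ∈ s, (φ i).toFun x := by
  classical
  induction s using Finset.induction_on with
  | empty => simp only [Finset.sum_empty]; rfl
  | insert a s ha ih => rw [Finset.sum_insert ha, Finset.sum_insert ha, Representation.SmoothInd.toFun_add, Pi.add_apply, ih]

/-- **THE TYPE VECTOR OF A SUBREPRESENTATION OF `Ind_H^G τ` (`τ` one-dimensional).**  `B ≤ H` a COMPACT subgroup (in `G`), `V` a `G`-stable submodule of the smooth induced representation,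
`f ∈ V` with `f(1) ≠ 0`.  Then there is `f′ ∈ V` with `f′(1) ≠ 0` and **`ρ(b) f′ = τ(b) • f′` for every `b ∈ B`** — the twisted average of §1 with `θ(x) = f(x)∕f(1)` (`= τ(x)` on `H` by
the section property ★ `SmoothInd.toFun_subgroup_mul`; multiplicative on `B`; `θ(s) = 1` for `s ∈ B ∩ Stab(f)` since `f(s) = (s·f)(1) = f(1) ≠ 0`; `Stab(f)` is open — ★ `isSmooth_smoothInd`),
and `f′(1) = Σ_r θ(r)⁻¹ f(r) = |R|·f(1) ≠ 0`. [cite: Casselman1995, §2.1, §3.3] [cite: Roche1998, §3] [cite: BernsteinZelevinsky1976, §2.3] -/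
theorem exists_typeVector_of_mem (B : Subgroup G) (hB : IsCompact (B : Set G)) (hBH : B ≤ H)
    (V : Subrepresentation (Representation.smoothIndRep H τ)) (f : Representation.SmoothInd H τ) (hfV : f ∈ V) (hf1 : f.toFun 1 ≠ 0) :
    ∃ f' : Representation.SmoothInd H τ, f' ∈ V ∧ f'.toFun 1 ≠ 0 ∧
      ∀ b (hb : b ∈ B), Representation.smoothIndRep H τ b f' = (τ (⟨b, hBH hb⟩ : ↥H) 1) • f' := by
  classical
  -- the open stabiliser and a finite transversal of `B ∕ (B ∩ Stab f)`
  have hsm : (Representation.smoothIndRep H τ).IsSmoothVector f := Representation.isSmooth_smoothInd H τ f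
  obtain ⟨R, hR⟩ := exists_isLeftTransversal (B := B) (T := (Representation.smoothIndRep H τ).stabilizerSubgroup f) hB hsm
  have hTv : ∀ t ∈ (Representation.smoothIndRep H τ).stabilizerSubgroup f, Representation.smoothIndRep H τ t f = f :=
    fun t ht => ((Representation.smoothIndRep H τ).mem_stabilizerSubgroup f t).1 ht
  -- `θ(x) = f(x) ∕ f(1)`; on `H` it is `τ(x) 1`
  set θ : G → ℂ := fun x => f.toFun x * (f.toFun 1)⁻¹ with hθ
  have hθH : ∀ x (hx : x ∈ H), θ x = τ (⟨x, hx⟩ : ↥H) 1 := by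
    intro x hx
    have h := f.toFun_subgroup_mul (⟨x, hx⟩ : ↥H) 1
    rw [mul_one, apply_eq_mul_one] at h
    change f.toFun x * (f.toFun 1)⁻¹ = _
    rw [h, mul_assoc, mul_inv_cancel₀ hf1, mul_one]
  have hθmul : ∀ x ∈ B, ∀ y ∈ B, θ (x * y) = θ x * θ y := by
    intro x hx y hy
    rw [hθH x (hBH hx), hθH y (hBH hy), hθH (x * y) (hBH (B.mul_mem hx hy))]
    have : (⟨x * y, hBH (B.mul_mem hx hy)⟩ : ↥H) = (⟨x, hBH hx⟩ : ↥H) * (⟨y, hBH hy⟩ : ↥H) := rfl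
    rw [this, map_mul, Module.End.mul_apply, apply_eq_mul_one H τ (⟨x, hBH hx⟩ : ↥H)]
  have hθ0 : ∀ x ∈ B, θ x ≠ 0 := by
    intro x hx
    rw [hθH x (hBH hx)]
    intro h0
    have hinv : τ ((⟨x, hBH hx⟩ : ↥H)⁻¹) (τ (⟨x, hBH hx⟩ : ↥H) 1) = 1 := by
      rw [← Module.End.mul_apply, ← map_mul, inv_mul_cancel, MonoidHom.map_one, Module.End.one_apply]
    rw [h0, map_zero] at hinv
    exact zero_ne_one hinv
  have hθS : ∀ s ∈ B, s ∈ (Representation.smoothIndRep H τ).stabilizerSubgroup f → θ s = 1 := by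
    intro s _ hs
    have h := congrArg (fun φ : Representation.SmoothInd H τ => φ.toFun 1) (hTv s hs)
    simp only [Representation.toFun_smoothIndRep_apply, one_mul] at h
    change f.toFun s * (f.toFun 1)⁻¹ = 1
    rw [h, mul_inv_cancel₀ hf1]
  refine ⟨∑ r ∈ R, (θ r)⁻¹ • Representation.smoothIndRep H τ r f, sum_twisted_mem (Representation.smoothIndRep H τ) V hfV θ R, ?_, fun b hb => ?_⟩
  · -- `f′(1) = |R| · f(1)`
    have hval : ∀ r ∈ R, ((θ r)⁻¹ • Representation.smoothIndRep H τ r f).toFun 1 = f.toFun 1 := by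
      intro r hr
      have hrB : r ∈ B := hR.mem_of_mem r hr
      rw [Representation.SmoothInd.toFun_smul, Pi.smul_apply, Representation.toFun_smoothIndRep_apply, one_mul, smul_eq_mul]
      have hθr : θ r = f.toFun r * (f.toFun 1)⁻¹ := rfl
      rw [hθr, mul_inv, inv_inv]
      have hfr : f.toFun r ≠ 0 := by
        intro h0
        exact hθ0 r hrB (by rw [hθr, h0, zero_mul])
      field_simp
    rw [toFun_sum_apply H τ R (fun r => (θ r)⁻¹ • Representation.smoothIndRep H τ r f) 1, Finset.sum_congr rfl hval, Finset.sum_const, nsmul_eq_mul]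
    exact mul_ne_zero (Nat.cast_ne_zero.2 (Finset.card_pos.2 hR.nonempty).ne') hf1
  · rw [← hθH b (hBH hb)]
    exact sum_twisted_eigenvector (Representation.smoothIndRep H τ) hR hTv θ hθmul hθ0 hθS hb

end Induced

/-! ## §3 CM dress: the type vector inside the kernel subrepresentation of (V1) -/

variable (L : Type) [Field L] [NumberField L] [IsCMField L] (v : HeightOneSpectrum (𝓞 ↥(maximalRealSubfield L)))

set_option maxHeartbeats 16000000 in
set_option synthInstance.maxHeartbeats 400000 in
-- statement∕proof over the `SmoothInd` carrier of ★ `cmPrincipalSeries` + two subgroup memberships (class of ★ p857640 §3 ∕ ★ `criterion_of_data`)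
/-- **(V1)+(V2) AT `U(Φ₃)(L⁺_v)`: A REDUCIBLE `i_G(χ₁, χ₂)` WITH `χ₁` NON-UNITARY CONTRACTING (ANY CONDUCTOR) CONTAINS A `G`-SUBREPRESENTATION `V ≠ ⊥` WHOSE MEMBERS ALL HAVE VANISHING
INTERTWINING INTEGRALS `∫_N f(w₀ n g) dn = 0`, AND A TYPE VECTOR `f ∈ V`: `f(1) ≠ 0` and `f(x b) = (f(b)∕f(1))·f(x)` for every `b` in the COMPACT PART `B_K = B ∩ K_v` of the Borel**
(`K_v = cmLocalIntegralLevel`; on `B_K` the scalar `f(b)∕f(1)` is the inducing character `χ(proj b)·δ_B^{1∕2}(b)` by the section property).  ★ p857640 §3 gives `V` and a section with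
`f(1) ≠ 0`; §2 averages it over `B_K` inside `V` (`B_K` is compact: closed `borelU` ★ ∩ compact `K_v` ★).  Input of (V3) (cell decomposition of `f` over `B\G∕J`).
[cite: Casselman1995, §3.3, §6.4] [cite: Roche1998, §3] [cite: BernsteinZelevinsky1976, §2.3] -/
theorem exists_typeVector_forall_intertwiningIntegral_eq_zero
    (hns : ∀ w : PlacesOver L v, IsCMField.complexConj L • w.1 = w.1)
    (χ₁ : (LocalRing L v)ˣ →* ℂˣ) (χ₂ : ↥(normOneUnits (conjLocal L (IsCMField.complexConj L) v)) →* ℂˣ)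
    (h₁ : Continuous fun x => ((χ₁ x : ℂˣ) : ℂ)) (h₂ : Continuous fun x => ((χ₂ x : ℂˣ) : ℂ)) (hnu : ∃ x, ‖((χ₁ x : ℂˣ) : ℂ)‖ ≠ 1)
    (hcontr : ∀ x : (LocalRing L v)ˣ, unitModulusChar (LocalRing L v) x < 1 → ‖((χ₁ x : ℂˣ) : ℂ)‖ < 1)
    (hred : ∃ N : Subrepresentation (cmPrincipalSeries L 3 v (cmTorusCharPair L v χ₁ χ₂)), N ≠ ⊥ ∧ N ≠ ⊤)
    (w₀ : ↥(unitaryGroupOfForm (conjLocal L (IsCMField.complexConj L) v) (cmLocalForm L 3 v))) (hw₀ : Units.val (w₀ : GL (Fin 3) (LocalRing L v)) = cmLocalForm L 3 v)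
    [MeasurableSpace ↥(cmBorelTriple L 3 v).N] [BorelSpace ↥(cmBorelTriple L 3 v).N] (μ : Measure ↥(cmBorelTriple L 3 v).N) [μ.IsHaarMeasure] :
    ∃ (V : Subrepresentation (cmPrincipalSeries L 3 v (cmTorusCharPair L v χ₁ χ₂)))
      (f : haveI := locallyCompactSpace_cmBorelU L 3 v
          Representation.SmoothInd (cmBorelTriple L 3 v).P
        (Representation.twist
          (((Representation.trivial ℂ ↥(torusU (conjLocal L (IsCMField.complexConj L) v) (cmLocalForm L 3 v)) ℂ).twist
            (cmTorusCharPair L v χ₁ χ₂)).comp (cmBorelTriple L 3 v).proj) (rootDeltaChar (cmBorelTriple L 3 v).P))),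
      f ∈ V ∧ f.toFun 1 ≠ 0 ∧
      (∀ b : ↥(unitaryGroupOfForm (conjLocal L (IsCMField.complexConj L) v) (cmLocalForm L 3 v)),
        b ∈ borelU (conjLocal L (IsCMField.complexConj L) v) (cmLocalForm L 3 v) → b ∈ cmLocalIntegralLevel L 3 (qsForm L) v →
          ∀ x : ↥(unitaryGroupOfForm (conjLocal L (IsCMField.complexConj L) v) (cmLocalForm L 3 v)),
            f.toFun (x * b) = f.toFun b * (f.toFun 1)⁻¹ * f.toFun x) ∧
      ∀ f', f' ∈ V → ∀ g : ↥(unitaryGroupOfForm (conjLocal L (IsCMField.complexConj L) v) (cmLocalForm L 3 v)),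
        ∫ n : ↥(cmBorelTriple L 3 v).N, f'.toFun (w₀ * (n : ↥(unitaryGroupOfForm (conjLocal L (IsCMField.complexConj L) v) (cmLocalForm L 3 v))) * g) ∂μ = 0 := by
  haveI := locallyCompactSpace_cmBorelU L 3 v
  obtain ⟨V, f₀, hf₀V, hf₀1, hzero⟩ :=
    K2E3IntertwiningKernelOfReducible.exists_section_apply_one_ne_zero_forall_intertwiningIntegral_eq_zero L v hns χ₁ χ₂ h₁ h₂ hnu hcontr hred w₀ hw₀ μ
  -- the compact part of the Borel: `B_K = borelU ⊓ K_v`, compact, inside `P`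
  have hBKc : IsCompact ((borelU (conjLocal L (IsCMField.complexConj L) v) (cmLocalForm L 3 v) ⊓ cmLocalIntegralLevel L 3 (qsForm L) v :
      Subgroup ↥(unitaryGroupOfForm (conjLocal L (IsCMField.complexConj L) v) (cmLocalForm L 3 v))) :
        Set ↥(unitaryGroupOfForm (conjLocal L (IsCMField.complexConj L) v) (cmLocalForm L 3 v))) := by
    rw [Subgroup.coe_inf]
    exact (isCompact_isOpen_cmLocalIntegralLevel L 3 (qsForm L) v).1.inter_left (isClosed_borelU (conjLocal L (IsCMField.complexConj L) v) (cmLocalForm L 3 v))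
  have hBKP : borelU (conjLocal L (IsCMField.complexConj L) v) (cmLocalForm L 3 v) ⊓ cmLocalIntegralLevel L 3 (qsForm L) v ≤ (cmBorelTriple L 3 v).P :=
    fun b hb => hb.1
  obtain ⟨f, hfV, hf1, heig⟩ := exists_typeVector_of_mem (cmBorelTriple L 3 v).P _ _ hBKc hBKP V f₀ hf₀V hf₀1
  refine ⟨V, f, hfV, hf1, fun b hbB hbK x => ?_, hzero⟩
  have hb : b ∈ borelU (conjLocal L (IsCMField.complexConj L) v) (cmLocalForm L 3 v) ⊓ cmLocalIntegralLevel L 3 (qsForm L) v := ⟨hbB, hbK⟩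
  have he : f.toFun (x * b) = (Representation.smoothIndRep (cmBorelTriple L 3 v).P _ b f).toFun x := rfl
  rw [he, heig b hb, Representation.SmoothInd.toFun_smul, Pi.smul_apply, smul_eq_mul]
  congr 1
  -- the eigenvalue `τ(b) 1` is `f(b) ∕ f(1)` by the section property
  have h := f.toFun_subgroup_mul (⟨b, hBKP hb⟩ : ↥(cmBorelTriple L 3 v).P) 1
  rw [mul_one, apply_eq_mul_one] at h
  rw [h, mul_assoc, mul_inv_cancel₀ hf1, mul_one]

end Summit.HodgeConjecture.HodgeConjecture.Cruxes.H413.K2E3TypeVectorOfSubrep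

end
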